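import Summits.QuantumFields.YangMills.Theorems.BalabanUVNodesN06AtRecord11ObligationsSectBn
import Literature.MathematicalPhysics.QuantumFieldTheory.Balaban1983to89.B9BackgroundsKLevelV1R

/-!
# BalabanUVNodes ∕ N06 ([B9], `Dag.B9_main`) — the certificate's `hg` obligation (the gauge reduction of (3.35), p. 408 ll. 1–6) is VACUOUS at def-Y's members FOR EVERY
# CLASS AND EVERY CONSTANT: `N06AtRecord11ObligationsHg.hg_obligation_vacuous` re-typed over `bg9YR 𝔸 G R₁ R₂ x` with a generic small-field constant `c`
# (CASCADE-R STEP 3 ∕ the c-generic Y-edition, HOME `pub-ymgap-dag-n06-d/R-EDITION-RECIPE.md` §2 row «hg_obligation_vacuous»)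

Track A of `YM-PLAN.md` (cell `pub-ymgap`, D-0062), node **N06** = [Balaban1985BackgroundPropagators]; seat `pub-ymgap-dag-n06-d` (gen 13).  `B9.GaugeReduction335 D c geo B InCube Gp GA Cinv`
is `∀ x, InCube x → …` and NO member of the bundle of record is «in the cube class» (node00-def-Y `not_inCubeY`), whatever the backgrounds `B` and the constant `c` — so the
obligation holds over the R-generic backgrounds `bg9YR` (node00-def-Y `B9BackgroundsKLevelV1R`) at any `c`, for ANY letter families `Gp GA Cinv`, by the same one-line proof.  ★ `hg_obligation_vacuousRC`; at `R := (regY335, regY336)`, `c := c35Y`,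
letters `(ops x).Gp ∕ .GA ∕ .Cinv` it is the landed `hg_obligation_vacuous` (rfl on objects).  HONEST FRAMING: vacuity bookkeeping; nothing of the printed gauge reduction proved or used; COUNT-NEUTRAL;
N06 NOT discharged; K1⁹ NOT closed; one finite 𝕋⁴ programme at fixed `ε` — NOT continuum ∕ OS ∕ mass gap ∕ Clay.  0 `def`, 0 `sorry`.
-/

noncomputable section

namespace Summit.QuantumFields.YangMills.BalabanUVNodes.N06HgVacuousRC

open Literature.MathematicalPhysics.QuantumFieldTheory.Balaban1983to89
open Literature.MathematicalPhysics.QuantumFieldTheory.Balaban1983to89.T4Continuum (T4Family FiniteEpsData)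
open Literature.MathematicalPhysics.QuantumFieldTheory.Balaban1983to89.DagBinding (WorldP leavesP B9LeafX)
open Literature.MathematicalPhysics.QuantumFieldTheory.Balaban1983to89.Node00
open Literature.MathematicalPhysics.QuantumFieldTheory.Balaban1983to89.B9PinMembersKLevelV1 (MemberY geo9Y bg9Y)
open Literature.MathematicalPhysics.QuantumFieldTheory.Balaban1983to89.B9PinGeometryKLevelV1 (dOmegaY OmKY inΛY unitDistY InCubeY c35Y not_inCubeY)
open Literature.MathematicalPhysics.QuantumFieldTheory.Balaban1983to89.B7Prop2SpecialUnitary (specialUnitaryUnits)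
open Literature.MathematicalPhysics.QuantumFieldTheory.Balaban1983to89.B9Thm37Whole (Ops Conv342 Sizes StaticOK Local342 Identities const37)
open Literature.MathematicalPhysics.QuantumFieldTheory.Balaban1983to89.B9Cor38Whole (WalkReading Locality W38OfOps)
open Literature.MathematicalPhysics.QuantumFieldTheory.Balaban1983to89.B9Thm37GlueCor36 (CoRealizes)
open Literature.MathematicalPhysics.QuantumFieldTheory.Balaban1983to89.B6RandomWalk (Ineq261)
open Literature.MathematicalPhysics.QuantumFieldTheory.Balaban1983to89.B9Thm34Ext (toB6)
open Literature.MathematicalPhysics.QuantumFieldTheory.Balaban1983to89.B9Thm314 (Thm314LocalPrinted IneqSupF)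
open Literature.MathematicalPhysics.QuantumFieldTheory.Balaban1983to89.B9SectBStepWhole
  (StepE StepL2n StepGlob StepH1 StepE4 StepH2 StepKer StepAnalytic)
open Summit.QuantumFields.YangMills.BalabanUVNodes.N06AtRecord11ObligationsSectBn (b9_main_of_up_view₁₁B10YZW_of_obligations_W38T314SectBnsupplied)
open scoped Matrix.Norms.L2Operator

variable {N : ℕ}

/-! ## §1 the `hg` obligation (the gauge reduction (3.35), p. 408) IS VACUOUS AT THE RECORD -/

open Literature.MathematicalPhysics.QuantumFieldTheory.Balaban1983to89.B9BackgroundsKLevelV1R (RegFamY bg9YR)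

variable (θ₃ : Stage3Params) (Mstar : ℕ)
  (R₁ R₂ : RegFamY θ₃.d₆ θ₃.ℓ₆ θ₃.hd' θ₃.hL' θ₃.b₀ θ₃.b₁ Mstar (Matrix (Fin N) (Fin N) ℂ)) (c : ℝ)
  (Gp GA : (x : MemberY θ₃.d₆ θ₃.ℓ₆ θ₃.hd' θ₃.hL' θ₃.b₀ θ₃.b₁ Mstar) →
    B9.KernelFamily (geo9Y x) (bg9YR (Matrix (Fin N) (Fin N) ℂ) (specialUnitaryUnits (Fin N)) R₁ R₂ x))
  (Cinv : (x : MemberY θ₃.d₆ θ₃.ℓ₆ θ₃.hd' θ₃.hL' θ₃.b₀ θ₃.b₁ Mstar) →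
    B9.SiteKernel (geo9Y x) (bg9YR (Matrix (Fin N) (Fin N) ℂ) (specialUnitaryUnits (Fin N)) R₁ R₂ x))

/-- ★ **THE `hg` OBLIGATION IS VACUOUS OVER ANY CLASS, AT ANY CONSTANT, FOR ANY LETTERS**: `B9.GaugeReduction335 (θ₃.d₆+1) c geo9Y (bg9YR … R₁ R₂ ·) InCubeY Gp GA Cinv` —
no member is in the cube class (node00-def-Y `not_inCubeY`).  [cite: Balaban1985BackgroundPropagators, p.408 ll.1–6 (the gauge reduction of (3.35)); Cor. 3.6 p.408 (the cube class; bookkeeping: vacuous at this pin)] -/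
theorem hg_obligation_vacuousRC :
    B9.GaugeReduction335 (θ₃.d₆ + 1) c geo9Y (bg9YR (Matrix (Fin N) (Fin N) ℂ) (specialUnitaryUnits (Fin N)) R₁ R₂) InCubeY Gp GA Cinv :=
  fun x hx => absurd hx (not_inCubeY x)

end Summit.QuantumFields.YangMills.BalabanUVNodes.N06HgVacuousRC

end
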